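import Literature.Analysis.FluidPDE.DeRosaPertTransportZ
import Literature.Analysis.FluidPDE.DeRosaPertStressErrors
import HarnessLib

/-!
# De Rosa's perturbation stage: the transport error (BDSV §6.1.2) by the Calderón–Zygmund route

Fourth and last file of the proof of the transport-error estimate under the core hypotheses of
the De Rosa port (plan and identities: `DeRosaPertTransportIdentity.lean`; the transported
potential: `DeRosaPertTransportZ.lean`). We prove

  `DeRosa.transportError_stageFact : StageFact (TransportBound transportSource)`,

i.e. along the common prefix of the stage facts, `‖ℛ(∂ₜw_{q+1} + (v̄_q·∇)w_{q+1})(t)‖_{C^{0,α}} ≤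
C δ_{q+1}^{1/2} δ_q^{1/2} λ_q λ_{q+1}^{-(1-4α)}` for every `t ∈ [0,T]` (BDSV Prop. 6.1 (6.1) for the
transport error, arXiv (6.8); De Rosa Prop. 5.13 for `R̊^E`, "taken from [BDLSV2017]"):
`ℛ(D_tw) = n⁻¹(ℛ curl(D_tZ) - ℛ div 𝒞)` (`DeRosa.advectiveDeriv_curl`), the order-zero operators
`ℛ curl`, `ℛ div` (Prop. C.1, the tree's `BDSV.holderCZBound_holds`), the `C^{0,α}` norms of `D_tZ`
(`DeRosa.transportZ_stageFact` and interpolation at the scale `λ_{q+1}`) and of `𝒞 = (∇v̄_l × Z)_l`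
(pointwise data (2.19) and `DeRosa.potentialBound_stageFact`, interpolation), and the parameter
inequalities `ℓ⁻¹ ≤ λ_{q+1}` (arXiv (6.4)), `λ_q ≤ λ_{q+1}`. The bound is first obtained at interior
times (where `D_t` of inactive summands vanishes) and extended to `t = 0, T` by lower semicontinuity
of `t ↦ ‖G(t)‖_{C^{0,α}}` for the jointly smooth `G = ℛ(D_t w_{q+1})` (`DeRosa.holderBound_of_Ioo`).

## References

* L. De Rosa, Comm. PDE 44 (2019) 335–365 = arXiv:1801.10235, §5.5 Prop. 5.13 (`R̊^E`).
* T. Buckmaster, C. De Lellis, L. Székelyhidi Jr., V. Vicol, CPAM 72 (2019) = arXiv:1701.08678,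
  §6.1.2 (arXiv (6.6)–(6.8)), Prop. 6.1 (6.1), §4.4, App. C Prop. C.1, (6.4).
-/

open MeasureTheory Set Filter
open scoped NNReal ENNReal ContDiff Topology

noncomputable section

namespace Literature.Analysis.FluidPDE

namespace DeRosa

open BDSV FunctionSpaces FunctionSpaces.Torus

/-- The flat three-torus `T³ = (ℝ/ℤ)³`, local notation. -/
local notation "𝕋³" => UnitAddTorus (Fin 3)

/-- Euclidean `ℝ³`, local notation. -/
local notation "ℝ³" => EuclideanSpace ℝ (Fin 3)

/-! ## Lower semicontinuity: bounds at interior times extend to `[0,T]` -/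

section LSC

variable {E : Type*} [NormedAddCommGroup E] [NormedSpace ℝ E] {T : ℝ}

/-- The split `‖g‖_{C^{0,r}} = ‖g‖_∞ + [lift g]_r`. [folklore] -/
theorem eContDiffHolderNorm_zero_split (r : ℝ≥0) (g : 𝕋³ → E) :
    Torus.eContDiffHolderNorm 0 r g = eSupNorm g + eHolderNorm r (lift g) := by
  rw [Torus.eContDiffHolderNorm, eContDiffHolderNorm_zero_eq, eSupNorm_lift]

omit [NormedSpace ℝ E] in
/-- A Hölder quotient is bounded by the Hölder seminorm. [folklore] -/
theorem quotient_le_eHolderNorm {X : Type*} [MetricSpace X] (r : ℝ≥0) (f : X → E) (y z : X) :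
    edist (f y) (f z) / edist y z ^ (r : ℝ) ≤ eHolderNorm r f := by
  by_cases hyz : edist (f y) (f z) = 0
  · rw [hyz, ENNReal.zero_div]; exact bot_le
  by_cases htop : eHolderNorm r f = ⊤
  · rw [htop]; exact le_top
  have hmem : MemHolder r f := eHolderNorm_ne_top.1 htop
  have hH := hmem.holderWith y z
  rw [← hmem.coe_nnHolderNorm_eq_eHolderNorm]
  exact ENNReal.div_le_of_le_mul hH

omit [NormedSpace ℝ E] in
/-- The Hölder seminorm is bounded by the supremum of the Hölder quotients (metric source).
[folklore] -/
theorem eHolderNorm_le_iSup_quotient {X : Type*} [MetricSpace X] (r : ℝ≥0) (f : X → E) :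
    eHolderNorm r f ≤ ⨆ p : X × X, edist (f p.1) (f p.2) / edist p.1 p.2 ^ (r : ℝ) := by
  set Q : ℝ≥0∞ := ⨆ p : X × X, edist (f p.1) (f p.2) / edist p.1 p.2 ^ (r : ℝ) with hQ
  by_cases hQt : Q = ⊤
  · rw [hQt]; exact le_top
  have hHW : HolderWith Q.toNNReal r f := by
    intro y z
    rw [ENNReal.coe_toNNReal hQt]
    have hq : edist (f y) (f z) / edist y z ^ (r : ℝ) ≤ Q :=
      le_iSup (fun p : X × X => edist (f p.1) (f p.2) / edist p.1 p.2 ^ (r : ℝ)) (y, z)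
    have hdt : edist y z ^ (r : ℝ) ≠ ⊤ := ENNReal.rpow_ne_top_of_nonneg r.coe_nonneg (edist_ne_top y z)
    by_cases hd0 : edist y z ^ (r : ℝ) = 0
    · by_cases hf0 : edist (f y) (f z) = 0
      · rw [hf0]; exact bot_le
      · rw [hd0, ENNReal.div_zero hf0] at hq
        exact absurd (top_le_iff.1 hq) hQt
    exact (ENNReal.div_le_iff_le_mul (Or.inl hd0) (Or.inl hdt)).1 hq
  exact hHW.eHolderNorm_le.trans (le_of_eq (ENNReal.coe_toNNReal hQt))

/-- **Bounds at interior times extend to `[0,T]`** (`T > 0`): if `G` is jointly continuous on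
`[0,T] × T³` and `‖G(t)‖_{C^{0,r}} ≤ c` for `t ∈ (0,T)`, then also for `t ∈ [0,T]` — the sup norm
and every Hölder quotient are continuous in `t`, so `t ↦ ‖G(t)‖_{C^{0,r}}` is lower semicontinuous.
[folklore] -/
theorem holderBound_of_Ioo {G : ℝ → 𝕋³ → E} (hT : 0 < T) (hG : ContinuousOn (stLift G) (Icc 0 T ×ˢ univ))
    {r : ℝ≥0} {c : ℝ≥0∞} (h : ∀ t ∈ Ioo 0 T, Torus.eContDiffHolderNorm 0 r (G t) ≤ c) :
    ∀ t ∈ Icc 0 T, Torus.eContDiffHolderNorm 0 r (G t) ≤ c := by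
  intro t₀ ht₀
  rw [eContDiffHolderNorm_zero_split]
  -- slices are continuous in `t`
  have hcont : ∀ y : ℝ³, ContinuousOn (fun t => G t (proj y)) (Icc 0 T) := by
    intro y
    have h1 : ContinuousOn (fun t : ℝ => (t, y)) (Icc 0 T) := (continuousOn_id).prodMk continuousOn_const
    have h2 := hG.comp h1 (fun t ht => mk_mem_prod ht (mem_univ _))
    refine h2.congr fun t _ => ?_
    simp only [Function.comp_apply, stLift_apply]
  have hclos : t₀ ∈ closure (Ioo 0 T) := by rw [closure_Ioo hT.ne]; exact ht₀
  haveI : (𝓝[Ioo 0 T] t₀).NeBot := mem_closure_iff_nhdsWithin_neBot.1 hclos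
  -- ### Step 1: each functional is at most `c` at `t₀`
  have step : ∀ (x : 𝕋³) (p : ℝ³ × ℝ³),
      ‖G t₀ x‖ₑ + edist (G t₀ (proj p.1)) (G t₀ (proj p.2)) / edist p.1 p.2 ^ (r : ℝ) ≤ c := by
    intro x p
    obtain ⟨yx, rfl⟩ := proj_surjective x
    -- the value at interior times
    have hval : ∀ t ∈ Ioo 0 T,
        ‖G t (proj yx)‖ₑ + edist (G t (proj p.1)) (G t (proj p.2)) / edist p.1 p.2 ^ (r : ℝ) ≤ c := by
      intro t ht
      refine le_trans (add_le_add (enorm_le_eSupNorm (G t) _) ?_) ((eContDiffHolderNorm_zero_split r (G t)).symm.le.trans (h t ht))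
      have hq := quotient_le_eHolderNorm r (lift (G t)) p.1 p.2
      rwa [lift_apply, lift_apply] at hq
    by_cases hp : p.1 = p.2
    · -- the quotient vanishes identically
      have hz : ∀ t, edist (G t (proj p.1)) (G t (proj p.2)) / edist p.1 p.2 ^ (r : ℝ) = 0 := fun t => by
        rw [hp, edist_self, ENNReal.zero_div]
      simp_rw [hz, add_zero] at hval ⊢
      have hφc : ContinuousWithinAt (fun t => ‖G t (proj yx)‖ₑ) (Ioo 0 T) t₀ :=
        ((continuous_enorm.comp_continuousOn (hcont yx)) t₀ ht₀).mono Ioo_subset_Icc_self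
      exact le_of_tendsto hφc.tendsto (eventually_nhdsWithin_of_forall hval)
    · have hd0 : edist p.1 p.2 ^ (r : ℝ) ≠ 0 := by
        intro h0
        rcases ENNReal.rpow_eq_zero_iff.1 h0 with ⟨h1, -⟩ | ⟨h1, -⟩
        · exact hp (edist_eq_zero.1 h1)
        · exact edist_ne_top _ _ h1
      have hA : ContinuousWithinAt (fun t => ‖G t (proj yx)‖ₑ) (Icc 0 T) t₀ :=
        (continuous_enorm.comp_continuousOn (hcont yx)) t₀ ht₀
      have hB : ContinuousWithinAt (fun t => edist (G t (proj p.1)) (G t (proj p.2)) / edist p.1 p.2 ^ (r : ℝ))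
          (Icc 0 T) t₀ := by
        have he : ContinuousOn (fun t => edist (G t (proj p.1)) (G t (proj p.2))) (Icc 0 T) :=
          continuous_edist.comp_continuousOn ((hcont p.1).prodMk (hcont p.2))
        exact ((ENNReal.continuous_div_const _ hd0).comp_continuousOn he) t₀ ht₀
      have hφc : ContinuousWithinAt
          (fun t => ‖G t (proj yx)‖ₑ + edist (G t (proj p.1)) (G t (proj p.2)) / edist p.1 p.2 ^ (r : ℝ))
          (Ioo 0 T) t₀ := (hA.add hB).mono Ioo_subset_Icc_self
      exact le_of_tendsto hφc.tendsto (eventually_nhdsWithin_of_forall hval)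
  -- ### Step 2: the norm is a supremum of the functionals
  calc eSupNorm (G t₀) + eHolderNorm r (lift (G t₀))
      ≤ (⨆ x, ‖G t₀ x‖ₑ) + ⨆ p : ℝ³ × ℝ³, edist (lift (G t₀) p.1) (lift (G t₀) p.2) / edist p.1 p.2 ^ (r : ℝ) :=
        add_le_add le_rfl (eHolderNorm_le_iSup_quotient r _)
    _ ≤ c := ENNReal.iSup_add_iSup_le fun x p => by
        have := step x p
        rwa [lift_apply, lift_apply]

end LSC

/-! ## Interpolation from pointwise data -/

section Interp

variable {Y : Type*} [NormedAddCommGroup Y] [NormedSpace ℝ Y]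

omit [NormedSpace ℝ Y] in
/-- The Hölder seminorm of the lift (Euclidean metric) is at most that on the torus (quotient
metric). [folklore] -/
private theorem eHolderNorm_lift_le' (r : ℝ≥0) (g : 𝕋³ → Y) : eHolderNorm r (lift g) ≤ eHolderNorm r g := by
  refine le_iInf₂ fun C hC => ?_
  exact (HolderWith.lift hC).eHolderNorm_le

/-- **`‖g‖_{C^{0,r}} ≤ (3√3 + 3) M Λ^r` from `‖g‖ ≤ M`, `‖∂_i g‖ ≤ MΛ`** (`Λ ≥ 1`, `r ≤ 1`): the split
`‖·‖_{0,r} = ‖·‖_∞ + [·]_r` and the interpolation App. A (A.3) in the tree's form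
`Torus.eHolderNorm_le_of_norm_le_of_norm_partialDeriv_le`. [cite: BuckmasterEtAl2018, App. A (A.3)] -/
theorem eContDiffHolderNorm_zero_le_interp {g : 𝕋³ → Y} (hg : IsContDiff 1 g) {r : ℝ≥0} (hr1 : r ≤ 1)
    {M Λ : ℝ} (hM : 0 ≤ M) (hΛ1 : 1 ≤ Λ) (h0 : ∀ x, ‖g x‖ ≤ M) (h1 : ∀ i x, ‖Torus.partialDeriv i g x‖ ≤ M * Λ) :
    Torus.eContDiffHolderNorm 0 r g ≤ ENNReal.ofReal ((Real.sqrt 3 * 3 + 3) * M * Λ ^ (r : ℝ)) := by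
  have hΛ0 : 0 < Λ := one_pos.trans_le hΛ1
  have hMΛ : 0 ≤ M * Λ := mul_nonneg hM hΛ0.le
  set ΛN : ℝ≥0 := ⟨Λ, hΛ0.le⟩ with hΛN
  have hΛN0 : 0 < ΛN := hΛ0
  have hM0' : ∀ x, ‖g x‖ ≤ (M.toNNReal : ℝ) := fun x => (h0 x).trans (le_of_eq (Real.coe_toNNReal _ hM).symm)
  have hM1' : ∀ (i : Fin 3) x, ‖Torus.partialDeriv i g x‖ ≤ ((M * Λ).toNNReal : ℝ) := fun i x =>
    (h1 i x).trans (le_of_eq (Real.coe_toNNReal _ hMΛ).symm)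
  have hHol := Torus.eHolderNorm_le_of_norm_le_of_norm_partialDeriv_le hg hr1
    (M₀ := M.toNNReal) (M₁ := (M * Λ).toNNReal) hΛN0 hM0' hM1'
  rw [Fintype.card_fin] at hHol
  have hE : ((NNReal.sqrt (3 : ℕ) * ((3 : ℕ) * (M * Λ).toNNReal) * ΛN⁻¹ ^ (1 - r : ℝ) +
      2 * M.toNNReal * ΛN ^ (r : ℝ) : ℝ≥0) : ℝ) = (Real.sqrt 3 * 3 + 2) * M * Λ ^ (r : ℝ) := by
    rw [← interp_scale_eq (M := M) (α := (r : ℝ)) hΛ0]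
    have hΛc : ((ΛN : ℝ≥0) : ℝ) = Λ := rfl
    have h2 : ((M.toNNReal : ℝ≥0) : ℝ) = M := Real.coe_toNNReal _ hM
    have h3 : (((M * Λ).toNNReal : ℝ≥0) : ℝ) = M * Λ := Real.coe_toNNReal _ hMΛ
    push_cast [h2, h3, hΛc]
    ring
  have hΛr : 1 ≤ Λ ^ (r : ℝ) := Real.one_le_rpow hΛ1 r.coe_nonneg
  rw [eContDiffHolderNorm_zero_split]
  have hsup : eSupNorm g ≤ ENNReal.ofReal M := eSupNorm_le_ofReal h0
  have hhol : eHolderNorm r (lift g) ≤ ENNReal.ofReal ((Real.sqrt 3 * 3 + 2) * M * Λ ^ (r : ℝ)) := by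
    refine (eHolderNorm_lift_le' r g).trans (hHol.trans (le_of_eq ?_))
    rw [← ENNReal.ofReal_coe_nnreal, hE]
  refine (add_le_add hsup hhol).trans ?_
  rw [← ENNReal.ofReal_add hM (by positivity)]
  refine ENNReal.ofReal_le_ofReal ?_
  have hMr : M ≤ M * Λ ^ (r : ℝ) := le_mul_of_one_le_right hM hΛr
  nlinarith [Real.sqrt_nonneg 3]

end Interp

/-! ## The tensor `𝒞` from pointwise data -/

section Tensor

variable {v Z : 𝕋³ → ℝ³}

/-- The sup norm of the matrix `(∂_j v_l · Z_k)_{jk}`. [folklore] -/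
theorem norm_transportMatrix_le {g₀ z₀ : ℝ} (hg : 0 ≤ g₀) (hg0 : ∀ c x, ‖Torus.partialDeriv c v x‖ ≤ g₀)
    (hz0 : ∀ x, ‖Z x‖ ≤ z₀) (l : Fin 3) (x : 𝕋³) : ‖transportMatrix v Z l x‖ ≤ g₀ * z₀ := by
  have hz : 0 ≤ z₀ := (norm_nonneg _).trans (hz0 x)
  refine (pi_norm_le_iff_of_nonneg (mul_nonneg hg hz)).2 fun j => (pi_norm_le_iff_of_nonneg (mul_nonneg hg hz)).2 fun k => ?_
  show ‖Torus.partialDeriv j v x l * Z x k‖ ≤ g₀ * z₀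
  rw [norm_mul]
  exact mul_le_mul ((PiLp.norm_apply_le (Torus.partialDeriv j v x) l).trans (hg0 j x))
    ((PiLp.norm_apply_le (Z x) k).trans (hz0 x)) (norm_nonneg _) hg

/-- **`‖𝒞_{·l}(x)‖ ≤ ‖curlMatrix‖ g₀ z₀`.** [folklore] -/
theorem norm_transportTensor_col_le {g₀ z₀ : ℝ} (hg : 0 ≤ g₀) (hg0 : ∀ c x, ‖Torus.partialDeriv c v x‖ ≤ g₀)
    (hz0 : ∀ x, ‖Z x‖ ≤ z₀) (l : Fin 3) (x : 𝕋³) : ‖transportTensor v Z x l‖ ≤ ‖curlMatrix‖ * (g₀ * z₀) := by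
  have e : transportTensor v Z x l = curlMatrix (transportMatrix v Z l x) := rfl
  rw [e]
  exact (curlMatrix.le_opNorm _).trans (mul_le_mul_of_nonneg_left (norm_transportMatrix_le hg hg0 hz0 l x) (norm_nonneg _))

/-- **The partial derivatives of the columns of `𝒞`**:
`∂_i 𝒞_{·l} = curlMatrix ((∂_i∂_j v)_l Z_k + (∂_j v)_l (∂_i Z)_k)_{jk}`. [folklore] -/
theorem partialDeriv_transportTensor_col (hv : IsSmooth v) (hZ : IsSmooth Z) (i l : Fin 3) (x : 𝕋³) :
    Torus.partialDeriv i (fun y => transportTensor v Z y l) x =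
      curlMatrix fun j k => Torus.partialDeriv i (Torus.partialDeriv j v) x l * Z x k +
        Torus.partialDeriv j v x l * Torus.partialDeriv i Z x k := by
  have hZ1 : IsContDiff 1 Z := hZ.isContDiff (by simp)
  have hdv1 : ∀ j, IsContDiff 1 (fun y => Torus.partialDeriv j v y l) := fun j =>
    ((hv.partialDeriv j).apply l).isContDiff (by simp)
  have hZk1 : ∀ k, IsContDiff 1 (fun y => Z y k) := fun k => (hZ.apply k).isContDiff (by simp)
  have hM1 : IsContDiff 1 (transportMatrix v Z l) := (isSmooth_transportMatrix hv hZ l).isContDiff (by simp)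
  rw [transportTensor_eq, partialDeriv_clm_apply curlMatrix hM1 i x]
  congr 1
  funext j k
  have e1 : Torus.partialDeriv i (transportMatrix v Z l) x j k =
      Torus.partialDeriv i (fun y => transportMatrix v Z l y j k) x := by
    have h := partialDeriv_clm_apply (matrixEntry j k) hM1 i x
    rw [matrixEntry_apply] at h
    rw [← h]
    rfl
  rw [e1]
  show Torus.partialDeriv i (fun y => Torus.partialDeriv j v y l * Z y k) x = _
  have hprod := partialDeriv_smul (F := ℝ) (hdv1 j) (hZk1 k) i x
  simp only [smul_eq_mul] at hprod
  rw [hprod, partialDeriv_apply_coord hZ1, partialDeriv_apply_coord ((hv.partialDeriv j).isContDiff (by simp))]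
  ring

/-- **`‖∂_i 𝒞_{·l}(x)‖ ≤ ‖curlMatrix‖ (g₁ z₀ + g₀ z₁)`.** [folklore] -/
theorem norm_partialDeriv_transportTensor_col_le (hv : IsSmooth v) (hZ : IsSmooth Z) {g₀ g₁ z₀ z₁ : ℝ}
    (hg : 0 ≤ g₀) (hg' : 0 ≤ g₁) (hg0 : ∀ c x, ‖Torus.partialDeriv c v x‖ ≤ g₀)
    (hg1 : ∀ i c x, ‖Torus.partialDeriv i (Torus.partialDeriv c v) x‖ ≤ g₁)
    (hz0 : ∀ x, ‖Z x‖ ≤ z₀) (hz1 : ∀ i x, ‖Torus.partialDeriv i Z x‖ ≤ z₁) (i l : Fin 3) (x : 𝕋³) :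
    ‖Torus.partialDeriv i (fun y => transportTensor v Z y l) x‖ ≤ ‖curlMatrix‖ * (g₁ * z₀ + g₀ * z₁) := by
  have hz : 0 ≤ z₀ := (norm_nonneg _).trans (hz0 x)
  have hz' : 0 ≤ z₁ := (norm_nonneg _).trans (hz1 0 x)
  rw [partialDeriv_transportTensor_col hv hZ i l x]
  refine (curlMatrix.le_opNorm _).trans (mul_le_mul_of_nonneg_left ?_ (norm_nonneg _))
  have hB : 0 ≤ g₁ * z₀ + g₀ * z₁ := by positivity
  refine (pi_norm_le_iff_of_nonneg hB).2 fun j => (pi_norm_le_iff_of_nonneg hB).2 fun k => ?_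
  show ‖Torus.partialDeriv i (Torus.partialDeriv j v) x l * Z x k + Torus.partialDeriv j v x l * Torus.partialDeriv i Z x k‖ ≤ _
  refine (norm_add_le _ _).trans (add_le_add ?_ ?_)
  · rw [norm_mul]
    exact mul_le_mul ((PiLp.norm_apply_le _ l).trans (hg1 i j x)) ((PiLp.norm_apply_le (Z x) k).trans (hz0 x))
      (norm_nonneg _) hg'
  · rw [norm_mul]
    exact mul_le_mul ((PiLp.norm_apply_le _ l).trans (hg0 j x)) ((PiLp.norm_apply_le _ k).trans (hz1 i x))
      (norm_nonneg _) hg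

/-- **The tensor `𝒞` in `C^{0,r}` from pointwise data** at one scale `L ≥ 1` (`g₁ ≤ g₀ L`,
`z₁ ≤ z₀ L`): `‖𝒞‖_{C^{0,r}} ≤ 3 (3√3+3) (2‖curlMatrix‖ g₀ z₀) L^r`. [cite: BuckmasterEtAl2018, App. A (A.2)–(A.3)] -/
theorem eContDiffHolderNorm_transportTensor_le (hv : IsSmooth v) (hZ : IsSmooth Z) {r : ℝ≥0} (hr1 : r ≤ 1)
    {g₀ g₁ z₀ z₁ L : ℝ} (hg : 0 ≤ g₀) (hg' : 0 ≤ g₁) (hz : 0 ≤ z₀) (hL1 : 1 ≤ L)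
    (hg0 : ∀ c x, ‖Torus.partialDeriv c v x‖ ≤ g₀) (hg1 : ∀ i c x, ‖Torus.partialDeriv i (Torus.partialDeriv c v) x‖ ≤ g₁)
    (hz0 : ∀ x, ‖Z x‖ ≤ z₀) (hz1 : ∀ i x, ‖Torus.partialDeriv i Z x‖ ≤ z₁) (hgL : g₁ ≤ g₀ * L) (hzL : z₁ ≤ z₀ * L) :
    Torus.eContDiffHolderNorm 0 r (transportTensor v Z) ≤
      3 * ENNReal.ofReal ((Real.sqrt 3 * 3 + 3) * (2 * (‖curlMatrix‖ * (g₀ * z₀))) * L ^ (r : ℝ)) := by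
  have hs := isSmooth_transportTensor hv hZ
  have hcs : ∀ l, IsContDiff ((0 : ℕ) : WithTop ℕ∞) (fun y => transportTensor v Z y l) := fun l =>
    ((contDiff_pi.1 hs) l).of_le (by simp)
  have hc1 : ∀ l, IsContDiff 1 (fun y => transportTensor v Z y l) := fun l =>
    ((contDiff_pi.1 hs) l).of_le (by exact_mod_cast le_top)
  set Mc : ℝ := ‖curlMatrix‖ * (g₀ * z₀) with hMc
  have hMc0 : 0 ≤ Mc := mul_nonneg (norm_nonneg _) (mul_nonneg hg hz)
  have hz' : 0 ≤ z₁ := le_trans (norm_nonneg _) (hz1 0 (0 : 𝕋³))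
  have hcol : ∀ l, Torus.eContDiffHolderNorm 0 r (fun y => transportTensor v Z y l) ≤
      ENNReal.ofReal ((Real.sqrt 3 * 3 + 3) * (2 * Mc) * L ^ (r : ℝ)) := by
    intro l
    refine eContDiffHolderNorm_zero_le_interp (hc1 l) hr1 (by positivity) hL1 (fun x => ?_) (fun i x => ?_)
    · exact (norm_transportTensor_col_le hg hg0 hz0 l x).trans (by rw [hMc]; linarith)
    · refine (norm_partialDeriv_transportTensor_col_le hv hZ hg hg' hg0 hg1 hz0 hz1 i l x).trans ?_
      rw [hMc]
      have h1 : g₁ * z₀ + g₀ * z₁ ≤ 2 * (g₀ * z₀) * L := by nlinarith [mul_le_mul_of_nonneg_right hgL hz, mul_le_mul_of_nonneg_left hzL hg]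
      calc ‖curlMatrix‖ * (g₁ * z₀ + g₀ * z₁) ≤ ‖curlMatrix‖ * (2 * (g₀ * z₀) * L) :=
            mul_le_mul_of_nonneg_left h1 (norm_nonneg _)
        _ = 2 * (‖curlMatrix‖ * (g₀ * z₀)) * L := by ring
  refine (eContDiffHolderNorm_zero_pi_le r _ hcs).trans ?_
  calc ∑ l, Torus.eContDiffHolderNorm 0 r (fun y => transportTensor v Z y l)
      ≤ ∑ _l : Fin 3, ENNReal.ofReal ((Real.sqrt 3 * 3 + 3) * (2 * Mc) * L ^ (r : ℝ)) := Finset.sum_le_sum fun l _ => hcol l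
    _ = 3 * ENNReal.ofReal ((Real.sqrt 3 * 3 + 3) * (2 * Mc) * L ^ (r : ℝ)) := by
        rw [Finset.sum_const, Finset.card_univ, Fintype.card_fin, nsmul_eq_mul, Nat.cast_ofNat]

end Tensor

/-! ## The parameter arithmetic -/

section Arith

/-- **The exponents**: `L⁻¹ ℓ^{-2α} λ_q^{α/2} L^α ≤ L^{-1+4α}` and `L⁻¹ L^α ≤ L^{-1+4α}` for `ℓ⁻¹ ≤ L`,
`1 ≤ λ_q ≤ L`, `0 < α`. [folklore] -/
theorem transport_exponents {ℓ lq L α : ℝ} (hℓ : 0 < ℓ) (hlq1 : 1 ≤ lq) (hlqL : lq ≤ L) (hℓL : ℓ⁻¹ ≤ L)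
    (hα : 0 < α) :
    L⁻¹ * (ℓ ^ (-(2 * α)) * lq ^ (α / 2) * L ^ α) ≤ L ^ (-1 + 4 * α) ∧ L⁻¹ * L ^ α ≤ L ^ (-1 + 4 * α) := by
  have hL1 : 1 ≤ L := hlq1.trans hlqL
  have hL0 : 0 < L := one_pos.trans_le hL1
  have hlq0 : 0 < lq := one_pos.trans_le hlq1
  have e1 : ℓ ^ (-(2 * α)) = ℓ⁻¹ ^ (2 * α) := by rw [Real.inv_rpow hℓ.le, Real.rpow_neg hℓ.le]
  have h1 : ℓ ^ (-(2 * α)) ≤ L ^ (2 * α) := by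
    rw [e1]; exact Real.rpow_le_rpow (inv_nonneg.2 hℓ.le) hℓL (by linarith)
  have h2 : lq ^ (α / 2) ≤ L ^ (α / 2) := Real.rpow_le_rpow hlq0.le hlqL (by linarith)
  have hLinv : L⁻¹ = L ^ (-1 : ℝ) := (Real.rpow_neg_one L).symm
  constructor
  · calc L⁻¹ * (ℓ ^ (-(2 * α)) * lq ^ (α / 2) * L ^ α)
        ≤ L⁻¹ * (L ^ (2 * α) * L ^ (α / 2) * L ^ α) := by
          refine mul_le_mul_of_nonneg_left ?_ (inv_nonneg.2 hL0.le)
          exact mul_le_mul (mul_le_mul h1 h2 (Real.rpow_nonneg hlq0.le _) (Real.rpow_nonneg hL0.le _)) le_rfl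
            (Real.rpow_nonneg hL0.le _) (mul_nonneg (Real.rpow_nonneg hL0.le _) (Real.rpow_nonneg hL0.le _))
      _ = L ^ (-1 + (2 * α + α / 2 + α)) := by
          rw [hLinv, ← Real.rpow_add hL0, ← Real.rpow_add hL0, ← Real.rpow_add hL0]
      _ ≤ L ^ (-1 + 4 * α) := Real.rpow_le_rpow_of_exponent_le hL1 (by linarith)
  · rw [hLinv, ← Real.rpow_add hL0]
    exact Real.rpow_le_rpow_of_exponent_le hL1 (by linarith)

/-- **The final real inequality of the transport error.** With `n⁻¹ = 2π L⁻¹`, `U = s τ⁻¹ λ_q^{α/2}`,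
`τ⁻¹ = s' λ_q ℓ^{-2α}`:
`n⁻¹ (A cK (C_T U) L^α + B (3 (cK (2 c_M (C_v s' λ_q) (C_z s)) L^α))) ≤ 2π cK (A C_T + 6 B c_M C_v C_z) · s s' λ_q L^{-1+4α}`.
[folklore] -/
theorem transport_arith {A B cK CT Cv Cz cM s s' lq L ℓ τ α : ℝ} (hA : 0 ≤ A) (hB : 0 ≤ B) (hcK : 0 ≤ cK)
    (hCT : 0 ≤ CT) (hCv : 0 ≤ Cv) (hCz : 0 ≤ Cz) (hcM : 0 ≤ cM) (hs : 0 ≤ s) (hs' : 0 ≤ s') (hℓ : 0 < ℓ)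
    (hlq1 : 1 ≤ lq) (hlqL : lq ≤ L) (hℓL : ℓ⁻¹ ≤ L) (hα : 0 < α) (hτ : τ⁻¹ = s' * lq * ℓ ^ (-(2 * α))) :
    2 * Real.pi * L⁻¹ * (A * (cK * (CT * (s * τ⁻¹ * lq ^ (α / 2))) * L ^ α) +
        B * (3 * (cK * (2 * (cM * (Cv * s' * lq * (Cz * s)))) * L ^ α))) ≤
      2 * Real.pi * cK * (A * CT + 6 * B * cM * Cv * Cz) * (s * s' * lq * L ^ (-1 + 4 * α)) := by
  obtain ⟨h1, h2⟩ := transport_exponents hℓ hlq1 hlqL hℓL hα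
  have hL0 : 0 < L := one_pos.trans_le (hlq1.trans hlqL)
  have hlq0 : 0 ≤ lq := zero_le_one.trans hlq1
  have hπ : 0 ≤ 2 * Real.pi := by positivity
  have hss : 0 ≤ s * s' * lq := mul_nonneg (mul_nonneg hs hs') hlq0
  rw [hτ]
  -- term 1
  have t1 : 2 * Real.pi * L⁻¹ * (A * (cK * (CT * (s * (s' * lq * ℓ ^ (-(2 * α))) * lq ^ (α / 2))) * L ^ α)) ≤
      2 * Real.pi * cK * (A * CT) * (s * s' * lq * L ^ (-1 + 4 * α)) := by
    have e : 2 * Real.pi * L⁻¹ * (A * (cK * (CT * (s * (s' * lq * ℓ ^ (-(2 * α))) * lq ^ (α / 2))) * L ^ α)) =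
        (2 * Real.pi * cK * (A * CT) * (s * s' * lq)) * (L⁻¹ * (ℓ ^ (-(2 * α)) * lq ^ (α / 2) * L ^ α)) := by ring
    rw [e, show 2 * Real.pi * cK * (A * CT) * (s * s' * lq * L ^ (-1 + 4 * α)) =
      (2 * Real.pi * cK * (A * CT) * (s * s' * lq)) * L ^ (-1 + 4 * α) by ring]
    exact mul_le_mul_of_nonneg_left h1 (by positivity)
  -- term 2
  have t2 : 2 * Real.pi * L⁻¹ * (B * (3 * (cK * (2 * (cM * (Cv * s' * lq * (Cz * s)))) * L ^ α))) ≤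
      2 * Real.pi * cK * (6 * B * cM * Cv * Cz) * (s * s' * lq * L ^ (-1 + 4 * α)) := by
    have e : 2 * Real.pi * L⁻¹ * (B * (3 * (cK * (2 * (cM * (Cv * s' * lq * (Cz * s)))) * L ^ α))) =
        (2 * Real.pi * cK * (6 * B * cM * Cv * Cz) * (s * s' * lq)) * (L⁻¹ * L ^ α) := by ring
    rw [e, show 2 * Real.pi * cK * (6 * B * cM * Cv * Cz) * (s * s' * lq * L ^ (-1 + 4 * α)) =
      (2 * Real.pi * cK * (6 * B * cM * Cv * Cz) * (s * s' * lq)) * L ^ (-1 + 4 * α) by ring]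
    exact mul_le_mul_of_nonneg_left h2 (by positivity)
  have e : 2 * Real.pi * L⁻¹ * (A * (cK * (CT * (s * (s' * lq * ℓ ^ (-(2 * α))) * lq ^ (α / 2))) * L ^ α) +
      B * (3 * (cK * (2 * (cM * (Cv * s' * lq * (Cz * s)))) * L ^ α))) =
      2 * Real.pi * L⁻¹ * (A * (cK * (CT * (s * (s' * lq * ℓ ^ (-(2 * α))) * lq ^ (α / 2))) * L ^ α)) +
        2 * Real.pi * L⁻¹ * (B * (3 * (cK * (2 * (cM * (Cv * s' * lq * (Cz * s)))) * L ^ α))) := by ring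
  rw [e]
  refine (add_le_add t1 t2).trans (le_of_eq ?_)
  ring

end Arith

/-! ## Assembly -/

section Assembly

set_option maxHeartbeats 1000000 in
/-- **The transport error estimate under the core hypotheses** (BDSV Prop. 6.1 (6.1) for the
transport term, §6.1.2, arXiv (6.8); De Rosa Prop. 5.13 for `R̊^E`): along the common prefix of the
stage facts, `‖ℛ(∂ₜw_{q+1} + (v̄_q·∇)w_{q+1})(t)‖_{C^{0,α}} ≤ C δ_{q+1}^{1/2} δ_q^{1/2} λ_q λ_{q+1}^{-(1-4α)}`
for all `t ∈ [0,T]`. Proof by the Calderón–Zygmund route of the module docstring. Thresholds: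
`α < min(α(Z), α(D_tZ), 1/2, βb(b-1), (b-1)(1-β)/3)`, `N̄ = max(N̄(Z), N̄(D_tZ), 1)`, `a` beyond the
thresholds of the bounds on `Z`, `D_tZ`, of `2δ_{q+2} ≤ δ_{q+1}λ_q^{-α}` and of (6.4).
[cite: BuckmasterEtAl2018, §6.1.2 (arXiv (6.8)) with Prop. 6.1 (6.1); Derosa2018 Prop. 5.13 (R̊^E)] -/
theorem transportError_stageFact : StageFact (TransportBound transportSource) := by
  intro 𝔚 c₀ hc₀ Cη β hβ hβ' b hb hb'
  obtain ⟨α₁, hα₁, hP⟩ := potentialBound_stageFact 𝔚 c₀ hc₀ Cη β hβ hβ' b hb hb'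
  obtain ⟨α₂, hα₂, hTZ⟩ := transportZ_stageFact 𝔚 c₀ hc₀ Cη β hβ hβ' b hb hb'
  have hαρ : 0 < β * b * (b - 1) := mul_pos (mul_pos hβ (by linarith)) (by linarith)
  have hα64 : 0 < (b - 1) * (1 - β) / 3 := div_pos (mul_pos (by linarith) (by linarith)) three_pos
  refine ⟨min (min α₁ α₂) (min (min (1 / 2) (β * b * (b - 1))) ((b - 1) * (1 - β) / 3)),
    lt_min (lt_min hα₁ hα₂) (lt_min (lt_min one_half_pos hαρ) hα64), ?_⟩
  intro α hα hαlt
  have hαα₁ : α < α₁ := lt_of_lt_of_le hαlt ((min_le_left _ _).trans (min_le_left _ _))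
  have hαα₂ : α < α₂ := lt_of_lt_of_le hαlt ((min_le_left _ _).trans (min_le_right _ _))
  have hαr : α < min (min (1 / 2) (β * b * (b - 1))) ((b - 1) * (1 - β) / 3) :=
    lt_of_lt_of_le hαlt (min_le_right _ _)
  have hα1 : α < 1 := by
    have := lt_of_lt_of_le hαr ((min_le_left _ _).trans (min_le_left _ _)); linarith
  have hαρ' : α < 2 * β * b * (b - 1) := by
    have := lt_of_lt_of_le hαr ((min_le_left _ _).trans (min_le_right _ _)); nlinarith
  have hαb : 3 * α / 2 < (b - 1) * (1 - β) := by
    have := lt_of_lt_of_le hαr (min_le_right _ _); nlinarith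
  obtain ⟨N₁, hP⟩ := hP α hα hαα₁
  obtain ⟨N₂, hTZ⟩ := hTZ α hα hαα₂
  -- the Hölder exponent as an `ℝ≥0` and the Calderón–Zygmund constants
  set r : ℝ≥0 := ⟨α, hα.le⟩ with hr
  have hr0 : 0 < r := hα
  have hr1 : r < 1 := hα1
  have hrα : Real.toNNReal α = r := by rw [hr]; exact Real.toNNReal_of_nonneg hα.le
  have hrR : ((r : ℝ≥0) : ℝ) = α := rfl
  clear_value r
  obtain ⟨Ccz, hCczT, hcz⟩ := holderCZBound_holds.antidivergence_curl_le hr0 hr1 0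
  obtain ⟨CR, hR⟩ := holder_antidivergence_tensorDivergence_le holderCZBound_holds hr0 hr1
  refine ⟨max (max N₁ N₂) 1, fun Cin C₀ => ?_⟩
  obtain ⟨C₁, a₁, ha₁, hP⟩ := hP Cin C₀
  obtain ⟨C₂, a₂, ha₂, hTZ⟩ := hTZ Cin C₀
  obtain ⟨aρ, haρ, hρ⟩ := exists_threshold_amp_succ_succ hb hαρ'
  obtain ⟨a₆, ha₆, h64⟩ := exists_threshold_mollScale_freq_succ hb.le hαb 1
  -- the constants
  set Cz : ℝ := max C₁ 0 with hCz
  set CT : ℝ := max C₂ 0 with hCT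
  set Cv : ℝ := max Cin 0 with hCv
  have hCz0 : 0 ≤ Cz := le_max_right _ _
  have hCT0 : 0 ≤ CT := le_max_right _ _
  have hCv0 : 0 ≤ Cv := le_max_right _ _
  set cK : ℝ := Real.sqrt 3 * 3 + 3 with hcK
  have hcK0 : 0 ≤ cK := by have := Real.sqrt_nonneg 3; rw [hcK]; positivity
  have hcM : 0 ≤ ‖curlMatrix‖ := norm_nonneg curlMatrix
  have hC₁z : C₁ ≤ Cz := le_max_left _ _
  have hC₂T : C₂ ≤ CT := le_max_left _ _
  have hCinv : Cin ≤ Cv := le_max_left _ _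
  clear_value Cz CT Cv
  set K : ℝ := 2 * Real.pi * cK * (Ccz.toReal * CT + 6 * (CR : ℝ) * ‖curlMatrix‖ * Cv * Cz) with hK
  refine ⟨K, max (max a₁ a₂) (max aρ a₆), lt_max_of_lt_left (lt_max_of_lt_left ha₁), ?_⟩
  intro a ha S H 𝒟
  have ha₁' : a₁ ≤ a := ((le_max_left _ _).trans (le_max_left _ _)).trans ha
  have ha₂' : a₂ ≤ a := ((le_max_right _ _).trans (le_max_left _ _)).trans ha
  have haρ' : aρ ≤ a := ((le_max_left _ _).trans (le_max_right _ _)).trans ha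
  have ha₆' : a₆ ≤ a := ((le_max_right _ _).trans (le_max_right _ _)).trans ha
  have ha1 : (1 : ℝ) ≤ a := le_trans ha₁.le ha₁'
  obtain ⟨eP0, eP1⟩ := hP a ha₁' S (H.of_le ((le_max_left _ _).trans (le_max_left _ _))) 𝒟
  have hTZ' := hTZ a ha₂' S (H.of_le ((le_max_right _ _).trans (le_max_left _ _))) 𝒟
  have H1 : CoreHypotheses ⟨β, α, a, b⟩ S 1 Cv C₀ := (H.of_le (le_max_right _ _)).mono_const ha1 hCinv
  have hsm : SmoothData ⟨β, α, a, b⟩ S 𝒟.cut.η 𝒟.D := H.smoothData ha1 (hρ a haρ' S.q) hc₀ 𝒟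
  have hT : 0 < S.T := H.pos_T
  have hU : UniqueDiffOn ℝ (Icc 0 S.T) := uniqueDiffOn_Icc hT
  have hℓL : 1 ≤ mollScale β α a b S.q * freq a b (S.q + 1) := h64 a ha₆' S.q
  -- the parameters at this stage
  set s : ℝ := Real.sqrt (amp β a b (S.q + 1)) with hs
  set s' : ℝ := Real.sqrt (amp β a b S.q) with hs'
  set lq : ℝ := freq a b S.q with hlq
  set L : ℝ := freq a b (S.q + 1) with hL
  set ℓ : ℝ := mollScale β α a b S.q with hℓ
  set τ : ℝ := Params.τ ⟨β, α, a, b⟩ S.q with hτdef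
  have hs0 : 0 ≤ s := Real.sqrt_nonneg _
  have hs'0 : 0 ≤ s' := Real.sqrt_nonneg _
  have hs'pos : 0 < s' := Real.sqrt_pos.2 (amp_pos ha1 _)
  have hlq0 : 0 < lq := freq_pos ha1 _
  have hlq1 : 1 ≤ lq := one_le_freq ha1 _
  have hL0 : 0 < L := freq_pos ha1 _
  have hL1 : 1 ≤ L := one_le_freq ha1 _
  have hlqL : lq ≤ L := freq_le_freq_succ ha1 hb.le S.q
  have hℓ0 : 0 < ℓ := mollScale_pos ha1 _
  have hℓL' : ℓ⁻¹ ≤ L := by rw [inv_le_iff_one_le_mul₀ hℓ0, mul_comm]; exact hℓL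
  have hτ0 : 0 < τ := glueScale_pos ha1 _
  have hτinv : τ⁻¹ = s' * lq * ℓ ^ (-(2 * α)) := by
    have e : τ = ℓ ^ (2 * α) / (s' * lq) := rfl
    rw [e, inv_div, Real.rpow_neg hℓ0.le, div_eq_mul_inv]
  -- `n_{q+1}` and `n_{q+1}⁻¹ = 2π λ_{q+1}⁻¹`
  set n : ℕ := Params.freqNat ⟨β, α, a, b⟩ (S.q + 1) with hn
  have hfreq : L = 2 * Real.pi * (n : ℝ) := by
    rw [hL, hn]; exact Params.freq_eq ⟨β, α, a, b⟩ (by show (0 : ℝ) ≤ a; linarith) (S.q + 1)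
  have hn0 : (0 : ℝ) < n := by
    have hf := hL0; rw [hfreq] at hf; exact pos_of_mul_pos_right hf (by positivity)
  have hninv : ((n : ℝ))⁻¹ = 2 * Real.pi * L⁻¹ := by rw [hfreq]; field_simp
  have hninv0 : 0 ≤ ((n : ℝ))⁻¹ := inv_nonneg.2 hn0.le
  clear_value s s' lq L ℓ τ
  -- the unit of `D_tZ`
  have hUnit : transportUnit ⟨β, α, a, b⟩ S = s * τ⁻¹ * lq ^ (α / 2) := by
    rw [transportUnit_eq]
    show Real.sqrt (amp β a b (S.q + 1)) * (Params.τ ⟨β, α, a, b⟩ S.q)⁻¹ * freq a b S.q ^ (α / 2) = _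
    rw [hs, hτdef, hlq]
  have hUnit0 : 0 ≤ s * τ⁻¹ * lq ^ (α / 2) :=
    mul_nonneg (mul_nonneg hs0 (inv_nonneg.2 hτ0.le)) (Real.rpow_nonneg hlq0.le _)
  -- ### the function `G = ℛ(D_t w)` and the reduction to interior times
  have hGsm : Torus.IsSmoothSpaceTimeOn (Icc 0 S.T)
      (fun t => Torus.antidivergence (transportSource ⟨β, α, a, b⟩ S 𝔚 𝒟.cut.η 𝒟.D t)) := by
    have hsrc : Torus.IsSmoothSpaceTimeOn (Icc 0 S.T) (transportSource ⟨β, α, a, b⟩ S 𝔚 𝒟.cut.η 𝒟.D) :=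
      ((hsm.perturbation 𝔚).timeDerivWithin hU).add (hsm.vbar.convect (hsm.perturbation 𝔚) hU)
    exact hsrc.antidivergence (convex_Icc 0 S.T) (by rw [interior_Icc]; exact nonempty_Ioo.2 hT)
  unfold TransportBound
  dsimp only
  rw [hrα]
  refine fun t₀ ht₀ => holderBound_of_Ioo hT hGsm.continuousOn (fun t ht => ?_) t₀ ht₀
  have ht' : t ∈ Icc 0 S.T := Ioo_subset_Icc_self ht
  -- ### the fields at time `t`
  set Zt : 𝕋³ → ℝ³ := potential ⟨β, α, a, b⟩ S 𝔚 𝒟.cut.η 𝒟.D t with hZt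
  set vt : 𝕋³ → ℝ³ := S.vbar t with hvt
  set dZt : 𝕋³ → ℝ³ := advectiveDeriv S.T S.vbar (potential ⟨β, α, a, b⟩ S 𝔚 𝒟.cut.η 𝒟.D) t with hdZt
  have hZs : IsSmooth Zt := (hsm.potential 𝔚).isSmooth_slice ht'
  have hvs : IsSmooth vt := H.eulerReynolds.smooth_velocity.isSmooth_slice ht'
  have hdZsm : Torus.IsSmoothSpaceTimeOn (Icc 0 S.T) (advectiveDeriv S.T S.vbar (potential ⟨β, α, a, b⟩ S 𝔚 𝒟.cut.η 𝒟.D)) :=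
    ((hsm.potential 𝔚).timeDerivWithin hU).add (hsm.vbar.convect (hsm.potential 𝔚) hU)
  have hdZs : IsSmooth dZt := hdZsm.isSmooth_slice ht'
  -- ### pointwise data
  have hz0 : ∀ x, ‖Zt x‖ ≤ Cz * s := fun x => (eP0 t ht' x).trans (mul_le_mul_of_nonneg_right hC₁z hs0)
  have hz1 : ∀ i x, ‖Torus.partialDeriv i Zt x‖ ≤ Cz * s * L := fun i x => by
    refine (eP1 i t ht' x).trans ?_
    show C₁ * (s * L) ≤ Cz * s * L
    nlinarith [mul_nonneg hs0 hL0.le, hC₁z]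
  have hv1 := H1.velocity 0 (Nat.zero_le _) t ht'
  have hv2 := H1.velocity 1 le_rfl t ht'
  simp only [Nat.cast_zero, neg_zero, Real.rpow_zero, mul_one, zero_add] at hv1
  simp only [Nat.cast_one, Real.rpow_neg_one, Nat.reduceAdd] at hv2
  rw [← hvt, ← hs', ← hlq] at hv1
  rw [← hvt, ← hs', ← hlq, ← hℓ] at hv2
  have hg0 : ∀ c x, ‖Torus.partialDeriv c vt x‖ ≤ Cv * s' * lq := fun c x => by
    have h := norm_partialDeriv_le_of_eContDiffHolderNorm_le (hvs.isContDiff (by simp))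
      (mul_nonneg hCv0 (mul_nonneg hs'0 hlq0.le)) hv1 c x
    refine h.trans (le_of_eq ?_); ring
  have hg1 : ∀ i c x, ‖Torus.partialDeriv i (Torus.partialDeriv c vt) x‖ ≤ Cv * s' * lq * ℓ⁻¹ := fun i c x => by
    have h := norm_partialDeriv_partialDeriv_le_of_eContDiffHolderNorm_le hvs
      (mul_nonneg hCv0 (mul_nonneg (mul_nonneg hs'0 hlq0.le) (inv_nonneg.2 hℓ0.le))) hv2 i c x
    refine h.trans (le_of_eq ?_); ring
  obtain ⟨hd0, hd1⟩ := hTZ' t ht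
  dsimp only at hd0 hd1
  rw [hUnit] at hd0 hd1
  rw [← hL] at hd1
  have hD0 : ∀ x, ‖dZt x‖ ≤ CT * (s * τ⁻¹ * lq ^ (α / 2)) := fun x =>
    (hd0 x).trans (mul_le_mul_of_nonneg_right hC₂T hUnit0)
  have hD1 : ∀ i x, ‖Torus.partialDeriv i dZt x‖ ≤ CT * (s * τ⁻¹ * lq ^ (α / 2)) * L := fun i x =>
    (hd1 i x).trans (mul_le_mul_of_nonneg_right (mul_le_mul_of_nonneg_right hC₂T hUnit0) hL0.le)
  -- ### the `C^{0,α}` norms of `D_tZ(t)` and of `𝒞(t)`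
  have hDZ : Torus.eContDiffHolderNorm 0 r dZt ≤ ENNReal.ofReal (cK * (CT * (s * τ⁻¹ * lq ^ (α / 2))) * L ^ α) := by
    have h := eContDiffHolderNorm_zero_le_interp (hdZs.isContDiff (by simp)) hr1.le (mul_nonneg hCT0 hUnit0) hL1 hD0 hD1
    rwa [hrR] at h
  have hC : Torus.eContDiffHolderNorm 0 r (transportTensor vt Zt) ≤
      3 * ENNReal.ofReal (cK * (2 * (‖curlMatrix‖ * (Cv * s' * lq * (Cz * s)))) * L ^ α) := by
    have h := eContDiffHolderNorm_transportTensor_le hvs hZs hr1.le (mul_nonneg (mul_nonneg hCv0 hs'0) hlq0.le)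
      (mul_nonneg (mul_nonneg (mul_nonneg hCv0 hs'0) hlq0.le) (inv_nonneg.2 hℓ0.le)) (mul_nonneg hCz0 hs0) hL1
      hg0 hg1 hz0 hz1 (mul_le_mul_of_nonneg_left hℓL' (mul_nonneg (mul_nonneg hCv0 hs'0) hlq0.le)) le_rfl
    rwa [hrR] at h
  -- ### Calderón–Zygmund
  have hA := hcz dZt hdZs
  have hCs : IsSmooth (transportTensor vt Zt) := isSmooth_transportTensor hvs hZs
  have hB := hR (transportTensor vt Zt) hCs
  -- ### the identity `ℛ(D_t w) = n⁻¹ (ℛ curl D_tZ - ℛ div 𝒞)`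
  have hdiv : ∀ x, Torus.divergence vt x = 0 := H.eulerReynolds.divFree t ht'
  have hsrc : transportSource ⟨β, α, a, b⟩ S 𝔚 𝒟.cut.η 𝒟.D t =
      ((n : ℝ))⁻¹ • (BDSV.curl dZt - Torus.tensorDivergence (transportTensor vt Zt)) := by
    funext x
    have e1 : transportSource ⟨β, α, a, b⟩ S 𝔚 𝒟.cut.η 𝒟.D t x =
        advectiveDeriv S.T S.vbar (perturbation ⟨β, α, a, b⟩ S 𝔚 𝒟.cut.η 𝒟.D) t x := rfl
    have e2 : perturbation ⟨β, α, a, b⟩ S 𝔚 𝒟.cut.η 𝒟.D = fun s' y =>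
        (((n : ℝ))⁻¹ • ContinuousLinearMap.id ℝ ℝ³) (BDSV.curl (potential ⟨β, α, a, b⟩ S 𝔚 𝒟.cut.η 𝒟.D s') y) := by
      funext s' y; rfl
    have hM : Torus.IsSmoothSpaceTimeOn (Icc 0 S.T) (fun s' y => BDSV.curl (potential ⟨β, α, a, b⟩ S 𝔚 𝒟.cut.η 𝒟.D s') y) :=
      (hsm.potential 𝔚).curl hU
    rw [e1, e2, advectiveDeriv_clm_apply (v := S.vbar) hT hM _ ht' x,
      advectiveDeriv_curl hT hsm.vbar (hsm.potential 𝔚) ht' hdiv x]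
    rfl
  have hcurls : IsSmooth (BDSV.curl dZt) := isSmooth_curl hdZs
  have hdivs : IsSmooth (Torus.tensorDivergence (transportTensor vt Zt)) := hCs.tensorDivergence
  have hRA : IsSmooth (Torus.antidivergence (BDSV.curl dZt)) := Torus.isSmooth_antidivergence hcurls
  have hRB : IsSmooth (Torus.antidivergence (Torus.tensorDivergence (transportTensor vt Zt))) :=
    Torus.isSmooth_antidivergence hdivs
  have hRid : Torus.antidivergence (transportSource ⟨β, α, a, b⟩ S 𝔚 𝒟.cut.η 𝒟.D t) =
      ((n : ℝ))⁻¹ • (Torus.antidivergence (BDSV.curl dZt) - Torus.antidivergence (Torus.tensorDivergence (transportTensor vt Zt))) := by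
    rw [hsrc, Torus.antidivergence_const_smul (hcurls.sub hdivs), Torus.antidivergence_sub hcurls hdivs]
  -- ### assemble in `ℝ≥0∞`
  show Torus.eContDiffHolderNorm 0 r (Torus.antidivergence (transportSource ⟨β, α, a, b⟩ S 𝔚 𝒟.cut.η 𝒟.D t)) ≤ _
  rw [hRid, Torus.eContDiffHolderNorm_const_smul ((hRA.sub hRB).isContDiff (by simp)), Real.enorm_eq_ofReal hninv0]
  have hRA0 : IsContDiff ((0 : ℕ) : WithTop ℕ∞) (Torus.antidivergence (BDSV.curl dZt)) := hRA.isContDiff (by simp)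
  have hRB0 : IsContDiff ((0 : ℕ) : WithTop ℕ∞) (Torus.antidivergence (Torus.tensorDivergence (transportTensor vt Zt))) :=
    hRB.isContDiff (by simp)
  have hsub := Torus.eContDiffHolderNorm_sub_le (r := r) hRA0 hRB0
  have hX0 : 0 ≤ cK * (CT * (s * τ⁻¹ * lq ^ (α / 2))) * L ^ α := by positivity
  have hY0 : 0 ≤ cK * (2 * (‖curlMatrix‖ * (Cv * s' * lq * (Cz * s)))) * L ^ α := by positivity
  calc ENNReal.ofReal ((n : ℝ))⁻¹ *
        Torus.eContDiffHolderNorm 0 r (Torus.antidivergence (BDSV.curl dZt) -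
          Torus.antidivergence (Torus.tensorDivergence (transportTensor vt Zt)))
      ≤ ENNReal.ofReal ((n : ℝ))⁻¹ * (Ccz * ENNReal.ofReal (cK * (CT * (s * τ⁻¹ * lq ^ (α / 2))) * L ^ α) +
          CR * (3 * ENNReal.ofReal (cK * (2 * (‖curlMatrix‖ * (Cv * s' * lq * (Cz * s)))) * L ^ α))) := by
        refine mul_le_mul_of_nonneg_left (hsub.trans (add_le_add ?_ ?_)) bot_le
        · exact hA.trans (mul_le_mul_of_nonneg_left hDZ bot_le)
        · exact hB.trans (mul_le_mul_of_nonneg_left hC bot_le)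
    _ = ENNReal.ofReal (((n : ℝ))⁻¹ * (Ccz.toReal * (cK * (CT * (s * τ⁻¹ * lq ^ (α / 2))) * L ^ α) +
          (CR : ℝ) * (3 * (cK * (2 * (‖curlMatrix‖ * (Cv * s' * lq * (Cz * s)))) * L ^ α)))) := by
        rw [ENNReal.ofReal_mul hninv0, ENNReal.ofReal_add (mul_nonneg ENNReal.toReal_nonneg hX0)
            (mul_nonneg CR.coe_nonneg (mul_nonneg (by norm_num) hY0)),
          ENNReal.ofReal_mul ENNReal.toReal_nonneg, ENNReal.ofReal_toReal hCczT,
          ENNReal.ofReal_mul CR.coe_nonneg, ENNReal.ofReal_coe_nnreal,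
          ENNReal.ofReal_mul (by norm_num : (0 : ℝ) ≤ 3), ENNReal.ofReal_ofNat]
    _ ≤ _ := ENNReal.ofReal_le_ofReal ?_
  -- ### the real inequality
  rw [hninv]
  have key := transport_arith (A := Ccz.toReal) (B := (CR : ℝ)) (cM := ‖curlMatrix‖) ENNReal.toReal_nonneg CR.coe_nonneg
    hcK0 hCT0 hCv0 hCz0 hcM hs0 hs'0 hℓ0 hlq1 hlqL hℓL' hα hτinv
  refine key.trans (le_of_eq ?_)
  rw [hK, hs, hs', hlq, hL]

end Assembly

end DeRosa

end Literature.Analysis.FluidPDE
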